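import Literature.Analysis.FluidPDE.AnomalousDissipation
import HarnessLib

/-!
# Johansson–Sorella 2024: anomalous dissipation on `T³` with time-independent forces (Thm. 1.5)

C. J. P. Johansson, M. Sorella, *Anomalous dissipation via spontaneous stochasticity with a
two-dimensional autonomous velocity field*, arXiv:2409.03599 (2024), Theorem 1.5 (p. 5; proof §10,
pp. 45–46). Printed statement (verbatim from the held text):

"Theorem 1.5. For any α ∈ (0, 1), there exist a sequence of viscosity parameters {ν_q}_{q∈ℕ}, a
sequence of time independent smooth forces {F_{ν_q}}_{q∈ℕ} ⊂ C^∞(T³) and a sequence of smooth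
initial data {v_{in,q}}_{q∈ℕ} ⊂ C^∞(T³) such that for any q ≥ 1 there exists a unique solution
v_{ν_q} : [0,1] × T³ → ℝ³ to (1.2) [forced Navier–Stokes] and it enjoys the following properties:
(i) ‖F_{ν_q} − F_0‖_{C^α} + ‖v_{in,ν_q} − v_in‖_{C^α} → 0 as ν_q → 0 for some force F_0 ∈ C^α and
initial datum v_in ∈ C^α. (ii) Anomalous dissipation holds, i.e.
limsup_{ν_q→0} ν_q ∫₀¹ ∫_{T³} |∇v_{ν_q}(t,x)|² dx dt > 0. (iii) There exists v_0 ∈ L^∞ such that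
up to not relabelled subsequences v_{ν_q} ⇀* v_0 in L^∞ and v_0 is a solution to the 3D forced
Euler equations with v_in and force F_0 and finally e(t) = ½ ∫_{T³} |v_0(t,x)|² dx ∈ W^{1,∞}(0,1)."

The paper states (p. 5) that this "answers two open questions by Bruè and De Lellis posed in
[BDL23, Question 2.2 and Question 2.3]" — in the reading where the time-independent forces may
still depend on `ν`. It does NOT touch Bruè–De Lellis Question 2.1 (one `ν`-independent force):
see the registry docstring of `Literature.Analysis.FluidPDE.BrueDeLellisQuestion22`
(`AnomalousDissipation.lean`), which already cites this theorem in prose; the present file vendors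
it as a named fact so that routes can take it as a hypothesis.

## What is recorded, and how it relates to the print

* Spatial domain `T³ = UnitAddTorus (Fin 3)`, values in `ℝ³` (`T3`, `R3` of `AnomalousDissipation.lean`).
* Solutions are recorded as CLASSICAL (`Torus.IsClassicalNSSolutionOn (Icc 0 1)`, jointly `C^∞`):
  the printed theorem says "unique solution" with `C^∞` forces and data; in the proof (§10, p. 45)
  the solution is the explicit `2½`-dimensional field `v_{ν_q} = (u_{q+2}(x₁,x₂), θ^{κ_q}(t,x₁,x₂))`
  with `u_{q+2} ∈ C^∞(T²)` autonomous (an exact steady solution for the force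
  `F_{ν_q} = L(u_{q+2}·∇u_{q+2}) − ν_q Δu_{q+2}`) and `θ^{κ_q}` the solution of a linear
  advection–diffusion equation with smooth autonomous drift and smooth datum, hence jointly smooth
  on `[0,1] × T³` — the same convention as `bccds_onsager_critical` (loc. cit.). Uniqueness is not
  recorded (weaker).
* (ii) is printed in `limsup` form; passing to a subsequence realising the `limsup` (and then to a
  strictly decreasing one, `ν_q → 0`, `ν_q > 0`) gives the `ε`-eventually form
  `HasAnomalousDissipation` and `IsVanishingViscosity` used throughout `AnomalousDissipation.lean`
  (`brue_deLellis_anomalous_dissipation`, `bccds_onsager_critical`); all other clauses pass to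
  subsequences. So the `Prop` below is implied by the printed theorem.
* (i) is recorded with the tree's bounded Hölder norm on the torus
  (`FunctionSpaces.eBoundedHolderNorm`, `FunctionSpaces.MemBoundedHolder`, `HolderNorm.lean`):
  `F_0, v_in ∈ C^{0,α}_b(T³)` and `‖F_q − F_0‖_{C^{0,α}} + ‖v_{in,q} − v_in‖_{C^{0,α}} → 0` in `ℝ≥0∞`.
* (iii) (weak-* `L^∞` Euler limit with Lipschitz energy) is NOT recorded here (weaker than print;
  it needs an `L^∞_{t,x}` weak-* convergence clause not yet in the tree's torus API).

Relation to the summit routes: this is the nearest PROVED Navier–Stokes-side result to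
`Summit.AnomalousDissipation.AnomalousDissipation.Theses.EulerLimit.VanishingViscosityRealizationV2`
(stmt-AnomalousDissipation-1507) and to the target `EulerlimitThesisV2` (stmt-0511), which ask for ONE
steady force independent of `ν` (and τ-periodic classical approximants of a dissipative Euler flow);
here the steady forces `F_{ν_q}` DEPEND on `q` — the item is strictly STRONGER than this print, which
is recorded for comparison and as an admissible hypothesis, not as a match. A DEFINITION of the
statement (named fact, review-queued), no proof; users take `(h : johanssonSorella_autonomousForce_anomalousDissipation)`.
-/

open MeasureTheory Set Filter Topology
open scoped NNReal ENNReal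

noncomputable section

namespace Literature.Analysis.FluidPDE

/-- **Johansson–Sorella 2024, Theorem 1.5** (arXiv:2409.03599, p. 5; proof §10): anomalous
dissipation for forced 3D Navier–Stokes on `T³` with TIME-INDEPENDENT (but viscosity-dependent)
smooth forces. For every `α ∈ (0,1)` there are viscosities `ν_q ↓ 0`, time-independent smooth
forces `F_q ∈ C^∞(T³)`, smooth data `v_{in,q} ∈ C^∞(T³)` and classical solutions `(v_q, p_q)` of
`∂ₜv + (v·∇)v + ∇p = ν_q Δv + F_q`, `div v = 0`, `v_q(0) = v_{in,q}` on `[0,1] × T³`, such that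
(i) `F_q → F_0` and `v_{in,q} → v_in` in `C^{0,α}(T³)` for some `F_0, v_in ∈ C^{0,α}(T³)`, and
(ii) the dissipation is anomalous, `liminf_q ν_q ∫₀¹ ‖∇v_q‖²_{L²} > 0` (printed as `limsup > 0`;
pass to a subsequence). Clause (iii) of the print (weak-* `L^∞` limit solving forced Euler with
`W^{1,∞}` energy) and uniqueness are not recorded (weaker). Answers Bruè–De Lellis 2023
Questions 2.2–2.3 in the `ν`-dependent reading; does not answer Question 2.1
(`BrueDeLellisQuestion21/22` stay open). Nearest proved print to
`Summit.AnomalousDissipation.AnomalousDissipation.Theses.EulerLimit.VanishingViscosityRealizationV2`,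
which is STRONGER (one `ν`-independent steady force). [cite: JohanssonSorella2024, Thm. 1.5] -/
def johanssonSorella_autonomousForce_anomalousDissipation : Prop :=
  ∀ (α : ℝ≥0), 0 < α → α < 1 →
    ∃ (ν : ℕ → ℝ) (F vin : ℕ → T3 → R3) (v : ℕ → ℝ → T3 → R3) (p : ℕ → ℝ → T3 → ℝ)
      (F₀ vin₀ : T3 → R3),
      IsVanishingViscosity ν ∧
      (∀ q, FunctionSpaces.Torus.IsSmooth (F q)) ∧ (∀ q, FunctionSpaces.Torus.IsSmooth (vin q)) ∧
      (∀ q, FunctionSpaces.Torus.IsClassicalNSSolutionOn (Icc 0 1) (ν q) (fun _ => F q) (v q) (p q) ∧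
        v q 0 = vin q) ∧
      FunctionSpaces.MemBoundedHolder α F₀ ∧ FunctionSpaces.MemBoundedHolder α vin₀ ∧
      Tendsto (fun q => FunctionSpaces.eBoundedHolderNorm α (F q - F₀) +
        FunctionSpaces.eBoundedHolderNorm α (vin q - vin₀)) atTop (𝓝 0) ∧
      HasAnomalousDissipation ν v

end Literature.Analysis.FluidPDE

end
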